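import Literature.MathematicalPhysics.QuantumLattice.XXXAlgebraicBetheAnsatz
import Literature.MathematicalPhysics.QuantumLattice.HeisenbergModelProofs
import HarnessLib

/-!
# The inhomogeneous XXX chain: relabelling, support, trace identity and cyclic transport

Trunk T-QLATTICE, topic `MathematicalPhysics/QuantumLattice`. Complements to
`XXXAlgebraicBetheAnsatz.lean` (namespace `InhomXXX`) needed for the periodic boundary
conditions of the nested Bethe ansatz of the Hubbard chain, F. H. L. Essler, H. Frahm,
F. Göhmann, A. Klümper, V. E. Korepin, *The One-Dimensional Hubbard Model* (CUP 2005), App. 3.B.4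
"Periodic boundary conditions", eqs. (3.B.37)–(3.B.54), and (3.B.85)–(3.B.87) (held:
`book:essler2005-one-dimensional-hubbard-model`, PDF pp. 115–122). All statements proved, no
named facts.

## Contents

* `sUnit_mulVec_apply`, `swapOp_mulVec_apply`: the matrix units and the transposition operator
  `P_{xy}` act on coefficient vectors by `(P_{xy} v)(b) = v(b ∘ (x y))` ((3.B.24)).
* Relabelling (`reindexOp` of `SpinSystem`): `monodromy_map_reindexOp`, `reindexOp_bString`,
  `bString_vac_relabel : Φ_{e(l)}(b) = Φ_l(b ∘ e)` — renaming the sites of the chain permutes the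
  components of the Bethe vector (used when two electrons exchange their order).
* Support: `bString_vac_apply_eq_zero` — `𝔅(λ₁)⋯𝔅(λ_M)|0⟩` has exactly `M` down spins
  (`downCount`), via `monodromy_mulVec_support` (`T_{ac}` shifts the down-spin number by `c - a`).
* **Trace identity** (regularity of the Lax operator, `L_z(0) = η P_{a z}`):
  `transfer_at_inhomogeneity : t(s) = η ∏_{(m,s_m) ∈ l} ((s - s_m) + η P_{zm})` for the chain
  `l ++ [(z, s)]` (`rString`; Essler (3.B.53)–(3.B.54): `t(s_{P(1)} + iu) = X_{1N} ⋯ X_{12}`, their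
  `X_{jk}(v) = Π_{jk} Y_{jk}(v) = (v + η Π_{jk})/(v + η)` being `rString`'s factors up to the scalars
  `v + η`), through the quantisation map `auxToSite` and its multiplicativity.
* **Cyclic transport** `rString_mulVec_bString_vac` (iterated exchange relation (3.B.31) =
  `swapR_mulVec_bString_vac`): `(∏ R_{zm}) 𝔅_{l ++ [z]}|0⟩ = ∏ (s - s_m + η) 𝔅_{z :: l}|0⟩`, and the
  main result `bString_vac_cycle`: under the Bethe equations (divided form `coefA = coefD`),
  `𝔅_{(z,s) :: l}(λ⃗)|0⟩ = ∏_j (s - λ_j - η)/(s - λ_j) · 𝔅_{l ++ [(z,s)]}(λ⃗)|0⟩` — Essler's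
  periodicity condition (3.B.41)/(3.B.47) solved by the transfer-matrix eigenvalue (3.B.85):
  with `η = 2iu`, `s = sin k + iu` the factor is `∏_j (λ_j - sin k + iu)/(λ_j - sin k - iu)
  = e^{-ikL}` by the Lieb–Wu equation (3.B.86)/(3.95).

## Not in this file

The coordinate Bethe wave function of the Hubbard chain and its Schrödinger equation
(App. 3.B.1–3.B.3), which use these results (next file).
-/

noncomputable section

open Matrix Complex Finset

namespace Literature.MathematicalPhysics.QuantumLattice

namespace InhomXXX

variable {Λ : Type*} [Fintype Λ] [DecidableEq Λ]

/-! ### Action of matrix units and of the transposition operator on coefficient vectors -/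

/-- `(|a⟩⟨c|_x v)(b) = [b x = a] v(b[x ↦ c])`. [folklore] -/
theorem sUnit_mulVec_apply (x : Λ) (a c : Fin 2) (v : TensorIndex Λ 2 → ℂ) (b : TensorIndex Λ 2) :
    (sUnit x a c *ᵥ v) b = if b x = a then v (Function.update b x c) else 0 := by
  rw [sUnit]
  -- local copy of `onSite_mulVec_apply`
  have key : ((onSite x (Matrix.single a c (1 : ℂ)) : Op Λ 2) *ᵥ v) b =
      ∑ l : Fin 2, Matrix.single a c (1 : ℂ) (b x) l * v (Function.update b x l) := by
    have hinj : Function.Injective (Function.update b x : Fin 2 → TensorIndex Λ 2) :=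
      Function.update_injective b x
    have himg : ∀ τ : TensorIndex Λ 2, (∀ y, y ≠ x → b y = τ y) → τ = Function.update b x (τ x) := by
      intro τ h
      funext y
      by_cases hy : y = x
      · subst hy; simp
      · rw [Function.update_of_ne hy]; exact (h y hy).symm
    calc ((onSite x (Matrix.single a c (1 : ℂ)) : Op Λ 2) *ᵥ v) b
        = ∑ τ ∈ (univ : Finset (Fin 2)).image (Function.update b x),
            onSite x (Matrix.single a c (1 : ℂ)) b τ * v τ := by
          rw [mulVec, dotProduct]
          symm
          refine Finset.sum_subset (Finset.subset_univ _) fun τ _ hτ => ?_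
          rw [onSite_apply, if_neg, zero_mul]
          intro h
          exact hτ (Finset.mem_image.2 ⟨τ x, mem_univ _, (himg τ h).symm⟩)
      _ = ∑ l : Fin 2, onSite x (Matrix.single a c (1 : ℂ)) b (Function.update b x l) *
            v (Function.update b x l) := by
          rw [Finset.sum_image fun l _ l' _ h => hinj h]
      _ = _ := by
          refine Finset.sum_congr rfl fun l _ => ?_
          rw [onSite_apply, if_pos]
          · simp
          · intro y hy; rw [Function.update_of_ne hy]
  rw [key, Fin.sum_univ_two]
  by_cases h : b x = a
  · rw [if_pos h, h]
    rcases Fin.exists_fin_two.mp ⟨c, rfl⟩ with rfl | rfl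
    · rw [Matrix.single_apply_same, one_mul,
        Matrix.single_apply_of_col_ne a a (j := 0) (j' := 1) (by decide), zero_mul, add_zero]
    · rw [Matrix.single_apply_same, one_mul,
        Matrix.single_apply_of_col_ne a a (j := 1) (j' := 0) (by decide), zero_mul, zero_add]
  · rw [if_neg h, Matrix.single_apply_of_row_ne (Ne.symm h), Matrix.single_apply_of_row_ne (Ne.symm h),
      zero_mul, zero_mul, add_zero]

/-- **The transposition operator permutes the two spins**: `(P_{xy} v)(b) = v(b ∘ (x y))`.
[cite: EsslerEtAl2005, eq. (3.B.24)] -/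
theorem swapOp_mulVec_apply {x y : Λ} (hxy : x ≠ y) (v : TensorIndex Λ 2 → ℂ) (b : TensorIndex Λ 2) :
    (swapOp x y *ᵥ v) b = v (b ∘ Equiv.swap x y) := by
  unfold swapOp
  simp only [Matrix.sum_mulVec, Finset.sum_apply, ← mulVec_mulVec, sUnit_mulVec_apply,
    Function.update_of_ne (Ne.symm hxy)]
  rw [Finset.sum_eq_single (b x)]
  · rw [Finset.sum_eq_single (b y)]
    · rw [if_pos rfl, if_pos rfl]
      congr 1
      funext z
      simp only [Function.comp_apply]
      by_cases hzx : z = x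
      · subst hzx
        rw [Equiv.swap_apply_left, Function.update_of_ne hxy, Function.update_self]
      · by_cases hzy : z = y
        · subst hzy
          rw [Equiv.swap_apply_right, Function.update_self]
        · rw [Equiv.swap_apply_of_ne_of_ne hzx hzy, Function.update_of_ne hzy,
            Function.update_of_ne hzx]
    · intro c _ hc
      rw [if_pos rfl, if_neg (Ne.symm hc)]
    · intro h; exact absurd (mem_univ _) h
  · intro a _ ha
    refine Finset.sum_eq_zero fun c _ => ?_
    rw [if_neg (Ne.symm ha)]
  · intro h; exact absurd (mem_univ _) h


/-! ### Relabelling the sites of the chain -/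

section Relabel

variable {Λ' : Type*} [Fintype Λ'] [DecidableEq Λ']

/-- Relabelling moves matrix units: `reindexOp e |a⟩⟨b|_x = |a⟩⟨b|_{e x}`. [folklore] -/
theorem reindexOp_sUnit (e : Λ ≃ Λ') (x : Λ) (a b : Fin 2) :
    reindexOp e (sUnit x a b) = (sUnit (e x) a b : Op Λ' 2) :=
  reindexOp_onSite e x _

/-- Relabelling moves the Lax operator to the relabelled site. [folklore] -/
theorem lax_map_reindexOp (e : Λ ≃ Λ') (η : ℂ) (x : Λ) (c : ℂ) :
    (lax η x c).map (reindexOp (q := 2) e) = lax η (e x) c := by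
  ext a b : 2
  rw [Matrix.map_apply, lax_apply, lax_apply, map_add, map_smul, reindexOp_sUnit]
  split_ifs
  · rw [map_smul, map_one]
  · rw [map_zero]

/-- Relabelling the sites of the chain relabels the monodromy matrix entrywise. [folklore] -/
theorem monodromy_map_reindexOp (e : Λ ≃ Λ') (η lam : ℂ) (l : List (Λ × ℂ)) :
    (monodromy η lam l).map (reindexOp (q := 2) e) = monodromy η lam (l.map (Prod.map e id)) := by
  induction l with
  | nil =>
      rw [monodromy_nil, List.map_nil, monodromy_nil]
      exact Matrix.map_one _ (map_zero _) (map_one _)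
  | cons p l ih =>
      rw [monodromy_cons, List.map_cons, monodromy_cons, Prod.map_fst, Prod.map_snd, id,
        ← ih, ← lax_map_reindexOp e]
      exact Matrix.map_mul (f := (reindexOp (q := 2) e).toRingHom)

/-- Relabelling the sites of the chain relabels `B(λ)`. [folklore] -/
theorem reindexOp_opB (e : Λ ≃ Λ') (η lam : ℂ) (l : List (Λ × ℂ)) :
    reindexOp e (opB η lam l) = opB η lam (l.map (Prod.map e id)) := by
  rw [opB, opB, ← monodromy_map_reindexOp e, Matrix.map_apply]

/-- Relabelling the sites of the chain relabels the `B`-string. [folklore] -/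
theorem reindexOp_bString (e : Λ ≃ Λ') (η : ℂ) (l : List (Λ × ℂ)) (lams : List ℂ) :
    reindexOp e (bString η l lams) = bString η (l.map (Prod.map e id)) lams := by
  induction lams with
  | nil => rw [bString_nil, bString_nil, map_one]
  | cons mu rest ih => rw [bString_cons, bString_cons, map_mul, ih, reindexOp_opB]

/-- A relabelled operator acts on the reference state by permuting components:
`(reindexOp e A |0⟩)(b) = (A|0⟩)(b ∘ e)`. [folklore] -/
theorem reindexOp_mulVec_vac (e : Λ ≃ Λ') (A : Op Λ 2) (b : TensorIndex Λ' 2) :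
    (reindexOp e A *ᵥ vac) b = (A *ᵥ vac) (fun x => b (e x)) := by
  simp only [mulVec, dotProduct, reindexOp_apply]
  refine Fintype.sum_equiv (Equiv.arrowCongr e.symm (Equiv.refl (Fin 2))) _ _ fun τ => ?_
  have hτ : (Equiv.arrowCongr e.symm (Equiv.refl (Fin 2))) τ = fun x => τ (e x) := by
    funext x
    simp [Equiv.arrowCongr_apply]
  rw [hτ]
  congr 1
  simp only [vac_apply]
  congr 1
  simp only [eq_iff_iff]
  constructor
  · intro h
    funext x
    rw [h]
    rfl
  · intro h
    funext y
    have := congr_fun h (e.symm y)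
    simpa using this

/-- **Relabelling invariance of the Bethe vectors**: renaming the sites of the chain by a
bijection `e` permutes the components, `Φ_{e(l)}(b) = Φ_l(b ∘ e)`. [folklore] -/
theorem bString_vac_relabel (e : Λ ≃ Λ') (η : ℂ) (l : List (Λ × ℂ)) (lams : List ℂ)
    (b : TensorIndex Λ' 2) :
    (bString η (l.map (Prod.map e id)) lams *ᵥ vac) b = (bString η l lams *ᵥ vac) (fun x => b (e x)) := by
  rw [← reindexOp_bString, reindexOp_mulVec_vac]

end Relabel

/-! ### Support of the Bethe vectors: `B(λ)` creates exactly one down spin -/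

/-- The number of down spins of a configuration. [folklore] -/
def downCount (b : TensorIndex Λ 2) : ℕ := (Finset.univ.filter fun x => b x = 1).card

omit [DecidableEq Λ] in
/-- Splitting off one site from the down-spin count. [folklore] -/
theorem downCount_eq_erase_add [DecidableEq Λ] (b : TensorIndex Λ 2) (x : Λ) :
    downCount b = ((Finset.univ.erase x).filter fun y => b y = 1).card + (if b x = 1 then 1 else 0) := by
  unfold downCount
  rw [← Finset.insert_erase (Finset.mem_univ x), Finset.filter_insert]
  split_ifs with h
  · rw [Finset.card_insert_of_notMem]
    · rw [Finset.insert_erase (Finset.mem_univ x)]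
    · simp
  · rw [Finset.insert_erase (Finset.mem_univ x), add_zero]

/-- Down-spin count after changing one spin. [folklore] -/
theorem downCount_update (b : TensorIndex Λ 2) (x : Λ) (a : Fin 2) :
    (downCount (Function.update b x a) : ℤ) =
      downCount b - (if b x = 1 then 1 else 0) + (if a = 1 then 1 else 0) := by
  rw [downCount_eq_erase_add _ x, downCount_eq_erase_add b x, Function.update_self]
  have : ((Finset.univ.erase x).filter fun y => Function.update b x a y = 1) =
      ((Finset.univ.erase x).filter fun y => b y = 1) := by
    refine Finset.filter_congr fun y hy => ?_
    rw [Function.update_of_ne (Finset.ne_of_mem_erase hy)]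
  rw [this]
  push_cast
  ring

/-- Entries of the monodromy matrix shift the number of down spins by `c - a`:
if `v` is supported on configurations with `d` down spins, `T_{ac} v` is supported on
configurations with `d + c - a` down spins. [cite: EsslerEtAl2005, eq. (3.B.60)] -/
theorem monodromy_mulVec_support (η lam : ℂ) (l : List (Λ × ℂ)) :
    ∀ (a c : Fin 2) (v : TensorIndex Λ 2 → ℂ) (d : ℤ),
      (∀ b, (downCount b : ℤ) ≠ d → v b = 0) →
      ∀ b, (downCount b : ℤ) ≠ d + c - a → (monodromy η lam l a c *ᵥ v) b = 0 := by
  induction l with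
  | nil =>
      intro a c v d hv b hb
      rw [monodromy_nil, Matrix.one_apply]
      split_ifs with h
      · subst h
        rw [one_mulVec]
        exact hv b (by simpa using hb)
      · rw [zero_mulVec, Pi.zero_apply]
  | cons p l ih =>
      intro a c v d hv b hb
      rw [monodromy_cons_apply, add_mulVec, ← mulVec_mulVec, ← mulVec_mulVec, Pi.add_apply]
      have step : ∀ r : Fin 2, (lax η p.1 (lam - p.2) a r *ᵥ (monodromy η lam l r c *ᵥ v)) b = 0 := by
        intro r
        have hw := ih r c v d hv
        rw [lax_apply, add_mulVec, smul_mulVec, Pi.add_apply, Pi.smul_apply, sUnit_mulVec_apply]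
        have h1 : ((if a = r then (lam - p.2) • (1 : Op Λ 2) else 0) *ᵥ
            (monodromy η lam l r c *ᵥ v)) b = 0 := by
          split_ifs with har
          · subst har
            rw [smul_mulVec, one_mulVec, Pi.smul_apply, hw b hb, smul_zero]
          · rw [zero_mulVec, Pi.zero_apply]
        rw [h1, zero_add]
        split_ifs with hbr
        · rw [hw, smul_zero]
          rw [downCount_update, hbr]
          intro h
          apply hb
          rcases Fin.exists_fin_two.mp ⟨a, rfl⟩ with rfl | rfl <;>
          rcases Fin.exists_fin_two.mp ⟨r, rfl⟩ with rfl | rfl <;>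
          · simp at h ⊢; omega
        · rw [smul_zero]
      rw [step 0, step 1, add_zero]

/-- `𝔅(λ⃗)|0⟩` has exactly `M = |λ⃗|` down spins (integer form).
[cite: EsslerEtAl2005, §3.3 after eq. (3.94)] -/
theorem bString_vac_apply_eq_zero_int (η : ℂ) (l : List (Λ × ℂ)) :
    ∀ (lams : List ℂ) (b : TensorIndex Λ 2), (downCount b : ℤ) ≠ lams.length →
      (bString η l lams *ᵥ vac) b = 0
  | [], b, hb => by
      rw [bString_nil, one_mulVec, vac_apply, if_neg]
      intro h0
      apply hb
      subst h0
      simp [downCount]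
  | mu :: rest, b, hb => by
      rw [bString_cons, ← mulVec_mulVec, opB]
      refine monodromy_mulVec_support η mu l 0 1 _ (rest.length : ℤ)
        (bString_vac_apply_eq_zero_int η l rest) b ?_
      simpa using hb

/-- **`𝔅(λ⃗)|0⟩` has exactly `M = |λ⃗|` down spins.** [cite: EsslerEtAl2005, §3.3 after eq. (3.94)] -/
theorem bString_vac_apply_eq_zero (η : ℂ) (l : List (Λ × ℂ)) (lams : List ℂ) (b : TensorIndex Λ 2)
    (hb : downCount b ≠ lams.length) : (bString η l lams *ᵥ vac) b = 0 :=
  bString_vac_apply_eq_zero_int η l lams b (by exact_mod_cast hb)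


/-! ### Regularity of the Lax operator: the transfer matrix at `λ = s̃_z` -/

/-- The monodromy matrix of a concatenated chain is the product. [cite: EsslerEtAl2005, eq. (3.B.62)] -/
theorem monodromy_append (η lam : ℂ) (l₁ l₂ : List (Λ × ℂ)) :
    monodromy η lam (l₁ ++ l₂) = monodromy η lam l₁ * monodromy η lam l₂ := by
  induction l₁ with
  | nil => rw [List.nil_append, monodromy_nil, Matrix.one_mul]
  | cons p l ih => rw [List.cons_append, monodromy_cons, monodromy_cons, ih, Matrix.mul_assoc]

/-- "Quantisation" of the auxiliary space onto the site `z`: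
`M ↦ Σ_{b,c} M_{bc} |b⟩⟨c|_z` (the partial trace `tr_a (M P_{a z})`).
[cite: EsslerEtAl2005, eq. (3.B.53)] -/
def auxToSite (z : Λ) (M : Matrix (Fin 2) (Fin 2) (Op Λ 2)) : Op Λ 2 :=
  ∑ b, ∑ c, M b c * sUnit z b c

/-- The quantised Lax operator at another site is the intertwiner `c + η P_{zm}`.
[cite: EsslerEtAl2005, eqs. (3.B.46), (3.B.53)] -/
theorem auxToSite_lax (η : ℂ) {z m : Λ} (hzm : z ≠ m) (c : ℂ) :
    auxToSite z (lax η m c) = c • (1 : Op Λ 2) + η • swapOp z m := by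
  unfold auxToSite
  have h1 : ∀ b d : Fin 2, lax η m c b d * sUnit z b d =
      (if b = d then c • sUnit z b d else 0) + η • (sUnit m d b * sUnit z b d) := by
    intro b d
    rw [lax_apply, add_mul, smul_mul_assoc]
    congr 1
    split_ifs
    · rw [smul_mul_assoc, one_mul]
    · rw [zero_mul]
  simp only [h1, Finset.sum_add_distrib, Finset.sum_ite_eq, Finset.mem_univ, if_true, ← Finset.smul_sum]
  rw [sum_sUnit_diag, swapOp_comm hzm, swapOp, Finset.sum_comm]

/-- The quantisation map is multiplicative when the second factor commutes with the site `z`.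
[folklore] -/
theorem auxToSite_mul (z : Λ) (M N : Matrix (Fin 2) (Fin 2) (Op Λ 2))
    (hN : ∀ (d c a b : Fin 2), Commute (sUnit z a b) (N d c)) :
    auxToSite z (M * N) = auxToSite z M * auxToSite z N := by
  unfold auxToSite
  rw [Finset.sum_mul_sum]
  refine Finset.sum_congr rfl fun b _ => ?_
  simp only [Matrix.mul_apply, Finset.sum_mul]
  simp only [Finset.mul_sum]
  rw [Finset.sum_comm]
  conv_rhs => rw [Finset.sum_comm]
  refine Finset.sum_congr rfl fun d _ => ?_
  conv_rhs => rw [Finset.sum_comm]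
  refine Finset.sum_congr rfl fun c _ => ?_
  rw [Finset.sum_eq_single d]
  · rw [mul_assoc (M b d) (sUnit z b d), ← mul_assoc (sUnit z b d), (hN d c b d).eq, mul_assoc (N d c),
      sUnit_mul_sUnit, if_pos rfl, mul_assoc]
  · intro d' _ hd'
    rw [mul_assoc (M b d) (sUnit z b d), ← mul_assoc (sUnit z b d), (hN d' c b d).eq, mul_assoc (N d' c),
      sUnit_mul_sUnit, if_neg (Ne.symm hd'), mul_zero, mul_zero]
  · intro h; exact absurd (mem_univ _) h

/-- The string of intertwiners `∏_{(m,s_m) ∈ l} ((s - s_m) + η P_{zm})` (list order).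
[cite: EsslerEtAl2005, eq. (3.B.47)] -/
def rString (η : ℂ) (z : Λ) (s : ℂ) (l : List (Λ × ℂ)) : Op Λ 2 :=
  (l.map fun p => (s - p.2) • (1 : Op Λ 2) + η • swapOp z p.1).prod

/-- The empty string of intertwiners is `1`. [folklore] -/
@[simp] theorem rString_nil (η : ℂ) (z : Λ) (s : ℂ) :
    rString η z s ([] : List (Λ × ℂ)) = 1 := by
  simp [rString]

/-- Unfolding the string of intertwiners. [folklore] -/
@[simp] theorem rString_cons (η : ℂ) (z : Λ) (s : ℂ) (p : Λ × ℂ) (l : List (Λ × ℂ)) :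
    rString η z s (p :: l) = ((s - p.2) • (1 : Op Λ 2) + η • swapOp z p.1) * rString η z s l := by
  simp [rString]

/-- **Trace identity** (regularity `L_z(0) = η P_{a z}`): quantising the monodromy matrix over a
chain avoiding `z` at the spectral parameter `λ` gives the string of intertwiners
`∏ ((λ - s_m) + η P_{zm})`. [cite: EsslerEtAl2005, eqs. (3.B.53)–(3.B.54)] -/
theorem auxToSite_monodromy (η lam : ℂ) (z : Λ) (l : List (Λ × ℂ)) (hz : z ∉ l.map Prod.fst) :
    auxToSite z (monodromy η lam l) = rString η z lam l := by
  induction l with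
  | nil =>
      rw [monodromy_nil, rString_nil]
      unfold auxToSite
      simp only [Matrix.one_apply, ite_mul, one_mul, zero_mul, Finset.sum_ite_eq, Finset.mem_univ,
        if_true, sum_sUnit_diag]
  | cons p l ih =>
      rw [List.map_cons, List.mem_cons, not_or] at hz
      rw [monodromy_cons, auxToSite_mul, ih hz.2, auxToSite_lax η hz.1, rString_cons]
      intro d c a b
      exact sUnit_commute_monodromy η lam l hz.2 a b d c

/-- **The transfer matrix at an inhomogeneity**: for the chain `l ++ [(z, s)]`,
`t(s) = η · ∏_{(m,s_m) ∈ l} ((s - s_m) + η P_{zm})` (Essler et al. (3.B.53)–(3.B.54) with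
`X_{jk}(v) = ((v) + η Π_{jk})/(v + η)`). [cite: EsslerEtAl2005, eqs. (3.B.53)–(3.B.54)] -/
theorem transfer_at_inhomogeneity (η : ℂ) (z : Λ) (s : ℂ) (l : List (Λ × ℂ))
    (hz : z ∉ l.map Prod.fst) :
    transfer η s (l ++ [(z, s)]) = η • rString η z s l := by
  rw [← auxToSite_monodromy η s z l hz, transfer, opA, opD, monodromy_append]
  simp only [monodromy_cons, monodromy_nil, Matrix.mul_one, Matrix.mul_apply, lax_apply, sub_self,
    zero_smul, ite_self, zero_add, mul_smul_comm, ← Finset.smul_sum]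
  unfold auxToSite
  rw [Fin.sum_univ_two (f := fun b => ∑ c, monodromy η s l b c * sUnit z b c), smul_add]

/-! ### Cyclic transport of a site through the chain -/

omit [Fintype Λ] [DecidableEq Λ] in
/-- Distinctness of sites is invariant under moving one entry of the chain. [folklore] -/
private theorem nodup_perm_middle {l₁ l : List (Λ × ℂ)} {p q : Λ × ℂ} {l₂ : List (Λ × ℂ)}
    (h : ((l₁ ++ p :: (l ++ q :: l₂))).map Prod.fst |>.Nodup) :
    ((l₁ ++ q :: p :: (l ++ l₂)).map Prod.fst).Nodup := by
  refine (List.Perm.nodup_iff (List.Perm.map Prod.fst ?_)).1 h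
  refine List.Perm.append_left l₁ ?_
  have h1 : (p :: (l ++ q :: l₂)).Perm (q :: p :: (l ++ l₂)) := by
    have := (List.perm_middle (a := q) (l₁ := p :: l) (l₂ := l₂))
    simpa using this
  exact h1

/-- Transport of the site `z` from behind the segment `l` to its front by the string of
intertwiners (iterated (3.B.31)):
`(∏_{m ∈ l} R_{zm}) 𝔅_{l₁ ++ l ++ z :: l₂}|0⟩ = ∏_{m ∈ l} (s - s_m + η) · 𝔅_{l₁ ++ z :: l ++ l₂}|0⟩`.
[cite: EsslerEtAl2005, eq. (3.B.45)] -/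
theorem rString_mulVec_bString_vac (η : ℂ) (z : Λ) (s : ℂ) (l : List (Λ × ℂ)) :
    ∀ (l₁ l₂ : List (Λ × ℂ)), ((l₁ ++ l ++ (z, s) :: l₂).map Prod.fst).Nodup → ∀ lams : List ℂ,
      rString η z s l *ᵥ (bString η (l₁ ++ l ++ (z, s) :: l₂) lams *ᵥ vac) =
        (l.map fun p => s - p.2 + η).prod • (bString η (l₁ ++ (z, s) :: (l ++ l₂)) lams *ᵥ vac) := by
  induction l with
  | nil =>
      intro l₁ l₂ _ lams
      simp
  | cons p l ih =>
      intro l₁ l₂ hnd lams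
      have hassoc : l₁ ++ p :: l ++ (z, s) :: l₂ = (l₁ ++ [p]) ++ l ++ (z, s) :: l₂ := by simp
      rw [rString_cons, ← mulVec_mulVec, hassoc, ih (l₁ ++ [p]) l₂ (by rw [← hassoc]; exact hnd) lams,
        mulVec_smul]
      have hassoc2 : l₁ ++ [p] ++ (z, s) :: (l ++ l₂) = l₁ ++ p :: (z, s) :: (l ++ l₂) := by simp
      rw [hassoc2]
      have hnd' : ((l₁ ++ (z, s) :: (p.1, p.2) :: (l ++ l₂)).map Prod.fst).Nodup := by
        have : ((l₁ ++ p :: (l ++ (z, s) :: l₂)).map Prod.fst).Nodup := by simpa using hnd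
        exact nodup_perm_middle this
      rw [swapR_mulVec_bString_vac η l₁ (l ++ l₂) hnd' lams, smul_smul, List.map_cons, List.prod_cons,
        mul_comm]
      simp only [Prod.mk.eta, List.cons_append]

omit [Fintype Λ] [DecidableEq Λ] in
/-- `d(s) = 0` for a chain containing the inhomogeneity `s`. [cite: EsslerEtAl2005, eq. (3.B.74)] -/
theorem dEig_append_self (s : ℂ) (z : Λ) (l : List (Λ × ℂ)) : dEig s (l ++ [(z, s)]) = 0 := by
  unfold dEig
  rw [List.map_append, List.prod_append]
  simp

omit [Fintype Λ] [DecidableEq Λ] in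
/-- `a(s) = η ∏_{m ∈ l} (s - s_m + η)` for the chain `l ++ [(z, s)]`.
[cite: EsslerEtAl2005, eq. (3.B.74)] -/
theorem aEig_append_self (η s : ℂ) (z : Λ) (l : List (Λ × ℂ)) :
    aEig η s (l ++ [(z, s)]) = (l.map fun p => s - p.2 + η).prod * η := by
  unfold aEig
  rw [List.map_append, List.prod_append]
  simp

/-- **Cyclic transport of the last site to the front** (Essler et al. (3.B.41), (3.B.45)–(3.B.47)
with (3.B.84)–(3.B.85)): under the Bethe equations, moving the site `z` (inhomogeneity `s`) from
the end of the chain to its front multiplies the Bethe vector by the eigenvalue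
`Λ(s)/a(s) = ∏_j (s - λ_j - η)/(s - λ_j)` of the transfer matrix at `λ = s`.
[cite: EsslerEtAl2005, eqs. (3.B.41), (3.B.45)–(3.B.47), (3.B.85)] -/
theorem bString_vac_cycle (η : ℂ) (hη : η ≠ 0) (z : Λ) (s : ℂ) (l : List (Λ × ℂ))
    (hnd : ((l ++ [(z, s)]).map Prod.fst).Nodup) (lams : List ℂ) (hlams : lams.Nodup) (hs : s ∉ lams)
    (hgen : ∀ p ∈ l, s - p.2 + η ≠ 0)
    (hBethe : ∀ j < lams.length, coefA η (l ++ [(z, s)]) (lams.getD j 0) (lams.eraseIdx j) =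
      coefD η (l ++ [(z, s)]) (lams.getD j 0) (lams.eraseIdx j)) :
    bString η ((z, s) :: l) lams *ᵥ vac =
      (lams.map fun mu => (s - mu - η) / (s - mu)).prod • (bString η (l ++ [(z, s)]) lams *ᵥ vac) := by
  have hz : z ∉ l.map Prod.fst := by
    rw [List.map_append, List.nodup_append] at hnd
    intro h
    exact hnd.2.2 _ h _ (by simp) rfl
  set C : ℂ := (l.map fun p => s - p.2 + η).prod with hC
  have hC0 : C ≠ 0 := by
    rw [hC]
    exact List.prod_ne_zero fun h => by
      obtain ⟨p, hp, hp0⟩ := List.mem_map.1 h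
      exact hgen p hp hp0
  -- the transfer matrix at `s` on the Bethe vector, computed in two ways
  have h1 := transfer_bString_vac η hη (l ++ [(z, s)]) hnd s lams hlams hs hBethe
  have h2 : transfer η s (l ++ [(z, s)]) *ᵥ (bString η (l ++ [(z, s)]) lams *ᵥ vac) =
      (η * C) • (bString η ((z, s) :: l) lams *ᵥ vac) := by
    rw [transfer_at_inhomogeneity η z s l hz, smul_mulVec, ← smul_smul]
    congr 1
    have := rString_mulVec_bString_vac η z s l [] [] (by simpa using hnd) lams
    simpa using this
  rw [h2, coefD, dEig_append_self, zero_mul, add_zero, coefA, aEig_append_self] at h1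
  rw [← hC] at h1
  apply smul_right_injective (TensorIndex Λ 2 → ℂ) (mul_ne_zero hη hC0)
  dsimp only
  rw [h1, smul_smul]
  congr 1
  ring

end InhomXXX

end Literature.MathematicalPhysics.QuantumLattice
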